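import Literature.Probability.LatticeModels.EffectiveResistance

/-!
# Kirchhoff's effective resistance formula — proof of `KirchhoffEdgeFormula`

This file discharges the named fact `KirchhoffEdgeFormula` of
`Literature/Probability/LatticeModels/EffectiveResistance.lean` (Kirchhoff 1847; Lyons–Peres 2016,
§4.2): for a finite connected network `(G, c)` with positive conductances and an edge `xy`,
`Σ_{t ∋ xy} Π_{f ∈ t} c(f) / Σ_t Π_{f ∈ t} c(f) = c(xy) · ℛ(x ↔ y)` over the spanning trees `t`.

Lyons–Peres prove the formula probabilistically (Wilson's algorithm, Corollary 4.4). We follow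
instead Kirchhoff's own combinatorial argument in the form printed in Grimmett 2018, §1.2,
Theorem 1.16 and its proof ("bushes" = spanning 2-forests), combined with Dirichlet's principle
(the definition of `effectiveConductance` in this tree):

* **Potential from 2-forests.** With `ℱ = twoForestEdgeSets G x y`, `wt(S) = Π_{f ∈ S} c(f)`,
  put `N(z) = Σ_{F ∈ ℱ, z ∈ side of x} wt(F)`, `D = Σ_{F ∈ ℱ} wt(F)` and
  `Tw = Σ_{T spanning tree} wt(T)`.
* **Kirchhoff's current law** (`laplacian_twoForestPotential`): for `z ≠ y`,
  `Σ_w c(zw) (N(z) - N(w)) = [z = x] · Tw`. Proof: the bush/tree correspondence `F ↦ F + zw`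
  (Grimmett's `ℬ(s,a,b,t) ↔ 𝒩(s,a,b,t)`, here `sum_twoForest_cross_eq_sum_tree`) turns both sides
  into sums over spanning trees, and for a single tree the s/t path enters and leaves an interior
  vertex equally often (`treeCross_sub_treeCross`, proved without developing paths in trees: via
  first edges of paths, `exists_firstEdge`, and a uniqueness statement, `firstEdge_unique`).
* **Dirichlet's principle** (`effectiveConductance_eq_of_harmonic`): a function harmonic off
  `{x, y}` with the boundary values `D, 0` minimises the energy, which equals `D · Tw`
  (discrete Green identity `sum_edgeFinset_mul_incr`), so `𝒞(x ↔ y) = Tw / D`.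
* Finally `Σ_{t ∋ xy} wt(t) = c(xy) · D` by the same correspondence at `z = x`, `w = y`.

## References

* [LyonsPeres2016] R. Lyons, Y. Peres, *Probability on Trees and Networks*, CUP 2016, §4.2,
  "Kirchhoff's Effective Resistance Formula" (p. 191 of the PDF held as
  `lyons2016-probability-trees-networks`), and the Remark following it (Kirchhoff 1847).
* [Grimmett2018] G. Grimmett, *Probability on Graphs*, 2nd ed., CUP 2018, §1.2, Theorem 1.16
  (Kirchhoff's theorem: the tree-count current satisfies the Kirchhoff laws) and §1.3
  (energy, `E(i) = [φ(t) - φ(s)] I_s`, Lemma 1.25).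
-/

namespace Literature.Probability.LatticeModels

open scoped ENNReal NNReal
open SimpleGraph Finset

noncomputable section

variable {V : Type*}

/-! ### Sums over edges versus sums over ordered pairs; the discrete Green identity -/

/-- `dv(e)² = dv(e) · dv(e)`. [folklore] -/
theorem sqIncr_eq_lift (v : V → ℝ) (e : Sym2 V) :
    sqIncr v e = Sym2.lift ⟨fun a b ↦ (v a - v b) * (v a - v b), fun a b ↦ by ring⟩ e := by
  induction e with
  | h a b => rw [sqIncr_mk, Sym2.lift_mk, sq]

/-- Polarisation of the squared increment: `d(v₀ + d)² = dv₀² + 2 dv₀ dd + dd²`, written for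
`v = v₀ + (v - v₀)`. [folklore] -/
theorem sqIncr_eq_sqIncr_add (v v₀ : V → ℝ) (e : Sym2 V) :
    sqIncr v e = sqIncr v₀ e +
      2 * Sym2.lift ⟨fun a b ↦ ((v a - v₀ a) - (v b - v₀ b)) * (v₀ a - v₀ b), fun a b ↦ by ring⟩ e +
      sqIncr (fun z ↦ v z - v₀ z) e := by
  induction e with
  | h a b => simp only [sqIncr_mk, Sym2.lift_mk]; ring

section Green

variable [Fintype V] [DecidableEq V] (G : SimpleGraph V) [DecidableRel G.Adj]

omit [DecidableEq V] in
/-- The energy of a potential on a finite network, as the `ofReal` of a real finite sum.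
[folklore] -/
theorem networkEnergy_eq_ofReal_sum (c : Sym2 V → ℝ≥0) (v : V → ℝ) :
    networkEnergy G c v = ENNReal.ofReal (∑ e ∈ G.edgeFinset, (c e : ℝ) * sqIncr v e) := by
  rw [networkEnergy_eq_sum,
    ENNReal.ofReal_sum_of_nonneg fun e _ ↦ mul_nonneg (NNReal.coe_nonneg _) (sqIncr_nonneg v e)]
  refine sum_congr rfl fun e _ ↦ ?_
  rw [ENNReal.ofReal_mul (NNReal.coe_nonneg _), ENNReal.ofReal_coe_nnreal]

/-- Symmetrisation: a sum over ordered adjacent pairs is the sum over the edges of the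
symmetrised summand. [folklore] -/
theorem sum_sum_adj_eq_sum_edgeFinset (g : V → V → ℝ) :
    ∑ z, ∑ w, (if G.Adj z w then g z w else 0) =
      ∑ e ∈ G.edgeFinset, Sym2.lift ⟨fun a b ↦ g a b + g b a, fun _ _ ↦ add_comm _ _⟩ e := by
  set A := (univ ×ˢ univ : Finset (V × V)).filter (fun p ↦ G.Adj p.1 p.2) with hA
  have hL : ∑ p ∈ A, g p.1 p.2 = ∑ z, ∑ w, (if G.Adj z w then g z w else 0) := by
    rw [hA, sum_filter, sum_product]
  have hmaps : ∀ p ∈ A, s(p.1, p.2) ∈ G.edgeFinset := fun p hp ↦ by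
    rw [mem_edgeFinset]
    exact (mem_filter.1 hp).2
  rw [← hL, ← sum_fiberwise_of_maps_to hmaps]
  refine sum_congr rfl fun e he ↦ ?_
  induction e with
  | h a b =>
    have hab : G.Adj a b := by simpa using he
    have hfib : A.filter (fun p ↦ s(p.1, p.2) = s(a, b)) = {(a, b), (b, a)} := by
      ext ⟨p, q⟩
      simp only [hA, mem_filter, mem_product, mem_univ, true_and, mem_insert, mem_singleton,
        Prod.mk.injEq]
      constructor
      · rintro ⟨-, h⟩
        exact Sym2.eq_iff.1 h
      · rintro (⟨rfl, rfl⟩ | ⟨rfl, rfl⟩)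
        · exact ⟨hab, rfl⟩
        · exact ⟨hab.symm, Sym2.eq_swap⟩
    have hne : (a, b) ≠ (b, a) := fun h ↦ hab.ne (Prod.mk.inj h).1
    rw [hfib, sum_pair hne]
    rfl

/-- **Discrete Green identity** (summation by parts on a finite network):
`Σ_{e = ab ∈ E} c(e) (u(a) - u(b)) (v(a) - v(b)) = Σ_z u(z) · Σ_{w ~ z} c(zw) (v(z) - v(w))`
(Grimmett 2018, Proposition 1.21 is the flow version). [folklore] -/
theorem sum_edgeFinset_mul_incr (c : Sym2 V → ℝ≥0) (u v : V → ℝ) :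
    ∑ e ∈ G.edgeFinset, (c e : ℝ) *
        Sym2.lift ⟨fun a b ↦ (u a - u b) * (v a - v b), fun a b ↦ by ring⟩ e =
      ∑ z, u z * ∑ w, (if G.Adj z w then (c s(z, w) : ℝ) * (v z - v w) else 0) := by
  have h : ∀ z, u z * ∑ w, (if G.Adj z w then (c s(z, w) : ℝ) * (v z - v w) else 0) =
      ∑ w, (if G.Adj z w then u z * ((c s(z, w) : ℝ) * (v z - v w)) else 0) := fun z ↦ by
    rw [mul_sum]
    exact sum_congr rfl fun w _ ↦ by rw [mul_ite, mul_zero]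
  simp_rw [h]
  rw [sum_sum_adj_eq_sum_edgeFinset]
  refine sum_congr rfl fun e _ ↦ ?_
  induction e with
  | h a b =>
    simp only [Sym2.lift_mk]
    rw [Sym2.eq_swap (a := b)]
    ring

/-- **Dirichlet's principle for a harmonic interpolant.** If `N : V → ℝ` takes the values `D > 0`
at `x` and `0` at `y` and its weighted Laplacian `Σ_{w ~ z} c(zw) (N(z) - N(w))` vanishes at every
`z ∉ {x, y}` and equals `Tw` at `x`, then `N / D` is the minimiser in Dirichlet's principle and
`𝒞(x ↔ y) = Tw / D` (Lyons–Peres 2016, Exercise 2.13; Grimmett 2018, §1.3, (1.22) and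
Lemma 1.25). [folklore] -/
theorem effectiveConductance_eq_of_harmonic (c : Sym2 V → ℝ≥0) {x y : V} (N : V → ℝ)
    {D Tw : ℝ} (hD : 0 < D) (hNx : N x = D) (hNy : N y = 0)
    (hharm : ∀ z, z ≠ y →
      ∑ w, (if G.Adj z w then (c s(z, w) : ℝ) * (N z - N w) else 0) = if z = x then Tw else 0) :
    effectiveConductance G c {x} {y} = ENNReal.ofReal (Tw / D) := by
  -- the candidate minimiser and its Laplacian
  set v₀ : V → ℝ := fun z ↦ N z / D with hv₀
  have hv₀x : v₀ x = 1 := by simp [hv₀, hNx, hD.ne']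
  have hv₀y : v₀ y = 0 := by simp [hv₀, hNy]
  have hlap : ∀ z, z ≠ y →
      ∑ w, (if G.Adj z w then (c s(z, w) : ℝ) * (v₀ z - v₀ w) else 0) =
        (if z = x then Tw else 0) / D := fun z hz ↦ by
    rw [← hharm z hz, div_eq_mul_inv, sum_mul]
    refine sum_congr rfl fun w _ ↦ ?_
    split_ifs
    · simp only [hv₀]
      ring
    · rw [zero_mul]
  -- real energies
  set E : (V → ℝ) → ℝ := fun v ↦ ∑ e ∈ G.edgeFinset, (c e : ℝ) * sqIncr v e with hE
  have hE₀ : E v₀ = Tw / D := by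
    calc E v₀ = ∑ e ∈ G.edgeFinset, (c e : ℝ) *
          Sym2.lift ⟨fun a b ↦ (v₀ a - v₀ b) * (v₀ a - v₀ b), fun a b ↦ by ring⟩ e := by
            simp only [hE, sqIncr_eq_lift]
      _ = ∑ z, v₀ z * ∑ w, (if G.Adj z w then (c s(z, w) : ℝ) * (v₀ z - v₀ w) else 0) :=
            sum_edgeFinset_mul_incr G c v₀ v₀
      _ = v₀ x * ∑ w, (if G.Adj x w then (c s(x, w) : ℝ) * (v₀ x - v₀ w) else 0) := by
            refine sum_eq_single x (fun z _ hzx ↦ ?_) (fun h ↦ (h (mem_univ x)).elim)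
            by_cases hzy : z = y
            · rw [hzy, hv₀y, zero_mul]
            · rw [hlap z hzy, if_neg hzx, zero_div, mul_zero]
      _ = Tw / D := by
            rcases eq_or_ne x y with rfl | hxy
            · -- impossible: `N x = D > 0` but `N y = 0`
              exact absurd (hNx.symm.trans hNy) hD.ne'
            · rw [hlap x hxy, if_pos rfl, hv₀x, one_mul]
  have hEv : ∀ v : V → ℝ, v x = 1 → v y = 0 → E v₀ ≤ E v := fun v hvx hvy ↦ by
    have hcross : ∑ e ∈ G.edgeFinset, (c e : ℝ) *
        Sym2.lift ⟨fun a b ↦ ((v a - v₀ a) - (v b - v₀ b)) * (v₀ a - v₀ b), fun a b ↦ by ring⟩ e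
          = 0 := by
      rw [sum_edgeFinset_mul_incr G c (fun z ↦ v z - v₀ z) v₀]
      refine sum_eq_zero fun z _ ↦ ?_
      by_cases hzy : z = y
      · rw [hzy, hvy, hv₀y, sub_zero, zero_mul]
      · rw [hlap z hzy]
        by_cases hzx : z = x
        · rw [hzx, hvx, hv₀x, sub_self, zero_mul]
        · rw [if_neg hzx, zero_div, mul_zero]
    have hsplit : E v = E v₀ + 2 * ∑ e ∈ G.edgeFinset, (c e : ℝ) *
        Sym2.lift ⟨fun a b ↦ ((v a - v₀ a) - (v b - v₀ b)) * (v₀ a - v₀ b), fun a b ↦ by ring⟩ e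
          + E (fun z ↦ v z - v₀ z) := by
      simp only [hE, mul_sum, ← sum_add_distrib]
      refine sum_congr rfl fun e _ ↦ ?_
      rw [sqIncr_eq_sqIncr_add v v₀ e]
      ring
    have hnonneg : 0 ≤ E (fun z ↦ v z - v₀ z) :=
      sum_nonneg fun e _ ↦ mul_nonneg (NNReal.coe_nonneg _) (sqIncr_nonneg _ e)
    rw [hsplit, hcross, mul_zero, add_zero]
    linarith
  -- conclude
  refine le_antisymm ?_ (le_effectiveConductance fun v hA hZ ↦ ?_)
  · calc effectiveConductance G c {x} {y} ≤ networkEnergy G c v₀ :=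
          effectiveConductance_le_networkEnergy (fun z hz ↦ by
            rw [Set.mem_singleton_iff.1 hz]; exact hv₀x) (fun z hz ↦ by
            rw [Set.mem_singleton_iff.1 hz]; exact hv₀y)
      _ = ENNReal.ofReal (Tw / D) := by rw [networkEnergy_eq_ofReal_sum, ← hE₀]
  · rw [networkEnergy_eq_ofReal_sum, ← hE₀]
    exact ENNReal.ofReal_le_ofReal (hEv v (hA rfl) (hZ rfl))

end Green

/-! ### Trees as edge sets: removing an edge, first edges of paths -/

section Trees

variable [DecidableEq V]

/-- Removing an edge `zw` from the edge set of a tree leaves an acyclic graph in which `z` and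
`w` are separated and every vertex is joined to `z` or to `w`. [folklore] -/
theorem isTree_erase {T : Finset (Sym2 V)} (hT : (fromEdgeSet (T : Set (Sym2 V))).IsTree)
    {z w : V} (hzw : z ≠ w) (he : s(z, w) ∈ T) :
    (fromEdgeSet (T.erase s(z, w) : Set (Sym2 V))).IsAcyclic ∧
      ¬ (fromEdgeSet (T.erase s(z, w) : Set (Sym2 V))).Reachable z w ∧
      ∀ u, (fromEdgeSet (T.erase s(z, w) : Set (Sym2 V))).Reachable z u ∨
        (fromEdgeSet (T.erase s(z, w) : Set (Sym2 V))).Reachable w u := by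
  have hins : ((T : Finset (Sym2 V)) : Set (Sym2 V)) =
      insert s(z, w) ((T.erase s(z, w) : Finset (Sym2 V)) : Set (Sym2 V)) := by
    rw [Finset.coe_erase, Set.insert_sdiff_singleton, Set.insert_eq_of_mem (Finset.mem_coe.2 he)]
  have hnot : s(z, w) ∉ ((T.erase s(z, w) : Finset (Sym2 V)) : Set (Sym2 V)) := by simp
  have h := hT
  rw [hins, isTree_fromEdgeSet_insert_iff hzw hnot] at h
  exact h

omit [DecidableEq V] in
/-- A walk in `fromEdgeSet S` avoiding the vertex `z` survives in `fromEdgeSet S'` whenever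
`S'` contains every element of `S` other than `s(z, w)`. [folklore] -/
theorem reachable_of_walk_avoiding {S S' : Finset (Sym2 V)} {z w a b : V}
    (hS : ∀ e ∈ S, e ≠ s(z, w) → e ∈ S') (p : (fromEdgeSet (S : Set (Sym2 V))).Walk a b)
    (hz : z ∉ p.support) : (fromEdgeSet (S' : Set (Sym2 V))).Reachable a b := by
  refine ⟨p.transfer _ fun e he ↦ ?_⟩
  have he' := p.edges_subset_edgeSet he
  rw [edgeSet_fromEdgeSet] at he' ⊢
  refine ⟨hS e he'.1 ?_, he'.2⟩
  rintro rfl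
  exact hz (p.fst_mem_support_of_mem_edges he)

/-- If `a` is joined to `b` but not to `z` in `T - e₁`, then `a` is joined to `b` in `T - zw`:
a walk from `a` that avoids the vertex `z` uses no edge at `z`. [folklore] -/
theorem reachable_erase_of_not_reachable {T : Finset (Sym2 V)} {e₁ : Sym2 V} {z w a b : V}
    (hab : (fromEdgeSet (T.erase e₁ : Set (Sym2 V))).Reachable a b)
    (haz : ¬ (fromEdgeSet (T.erase e₁ : Set (Sym2 V))).Reachable a z) :
    (fromEdgeSet (T.erase s(z, w) : Set (Sym2 V))).Reachable a b := by
  obtain ⟨p⟩ := hab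
  exact reachable_of_walk_avoiding (fun e he hne ↦ mem_erase.2 ⟨hne, (mem_erase.1 he).2⟩) p
    fun hz ↦ haz ⟨p.takeUntil z hz⟩

omit [DecidableEq V] in
/-- A path between distinct vertices has a first edge, and the rest of the path avoids the
starting vertex. [folklore] -/
theorem exists_adj_walk_notMem_support {H : SimpleGraph V} {z t : V} :
    ∀ p : H.Walk z t, p.IsPath → z ≠ t → ∃ w, H.Adj z w ∧ ∃ r : H.Walk w t, z ∉ r.support
  | .nil, _, hzt => (hzt rfl).elim
  | .cons h r, hp, _ => ⟨_, h, r, ((Walk.cons_isPath_iff h r).1 hp).2⟩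

/-- **First edge.** In a tree, for `z ≠ t` there is an edge `zw` of the tree whose removal
separates `z` from `t` but not `w` from `t` (the first edge of the path from `z` to `t`).
[folklore] -/
theorem exists_firstEdge {T : Finset (Sym2 V)} (hT : (fromEdgeSet (T : Set (Sym2 V))).IsTree)
    {z t : V} (hzt : z ≠ t) :
    ∃ w, s(z, w) ∈ T ∧ ¬ (fromEdgeSet (T.erase s(z, w) : Set (Sym2 V))).Reachable z t ∧
      (fromEdgeSet (T.erase s(z, w) : Set (Sym2 V))).Reachable w t := by
  obtain ⟨p⟩ := hT.connected.preconnected z t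
  obtain ⟨w, hadj, r, hr⟩ := exists_adj_walk_notMem_support p.bypass p.bypass_isPath hzt
  obtain ⟨he, hzw⟩ := (fromEdgeSet_adj _).1 hadj
  have hwt : (fromEdgeSet (T.erase s(z, w) : Set (Sym2 V))).Reachable w t :=
    reachable_of_walk_avoiding (fun e he' hne ↦ mem_erase.2 ⟨hne, he'⟩) r hr
  exact ⟨w, he, fun hzt' ↦ (isTree_erase hT hzw he).2.1 (hzt'.trans hwt.symm), hwt⟩

/-- **Uniqueness of the first edge.** At most one edge `zw` of `T` separates `z` from `t` while
keeping `w` joined to `t`. [folklore] -/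
theorem firstEdge_unique {T : Finset (Sym2 V)} {z t w₁ w₂ : V} (h₁ : s(z, w₁) ∈ T)
    (hn₁ : ¬ (fromEdgeSet (T.erase s(z, w₁) : Set (Sym2 V))).Reachable z t)
    (hr₁ : (fromEdgeSet (T.erase s(z, w₁) : Set (Sym2 V))).Reachable w₁ t)
    (hn₂ : ¬ (fromEdgeSet (T.erase s(z, w₂) : Set (Sym2 V))).Reachable z t) : w₁ = w₂ := by
  by_contra hne
  have hzw₁ : z ≠ w₁ := by
    rintro rfl
    exact hn₁ hr₁
  have h1 : (fromEdgeSet (T.erase s(z, w₂) : Set (Sym2 V))).Reachable t w₁ :=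
    reachable_erase_of_not_reachable hr₁.symm fun h ↦ hn₁ h.symm
  have h2 : (fromEdgeSet (T.erase s(z, w₂) : Set (Sym2 V))).Adj w₁ z := by
    rw [fromEdgeSet_adj]
    refine ⟨?_, hzw₁.symm⟩
    rw [Finset.mem_coe, mem_erase, Sym2.eq_swap (a := w₁) (b := z)]
    exact ⟨fun h ↦ hne (Sym2.congr_right.1 h), h₁⟩
  exact hn₂ (h1.trans h2.reachable).symm

/-- **The exchange step behind Kirchhoff's current law.** If the tree edge `zw` has `x, z` on one
side and `y, w` on the other and `z ≠ x`, then some tree edge `zw'` has `y, z` on one side and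
`x, w'` on the other (namely the first edge of the path from `z` to `x`): the `x`–`y` path of the
tree that leaves `z` through `zw` entered `z` through `w'z`. [folklore] -/
theorem exists_crossEdge {T : Finset (Sym2 V)} (hT : (fromEdgeSet (T : Set (Sym2 V))).IsTree)
    {x y z w : V} (hzx : z ≠ x) (hzw : z ≠ w) (hw : s(z, w) ∈ T)
    (hxz : (fromEdgeSet (T.erase s(z, w) : Set (Sym2 V))).Reachable x z)
    (hyw : (fromEdgeSet (T.erase s(z, w) : Set (Sym2 V))).Reachable y w) :
    ∃ w', s(z, w') ∈ T ∧ (fromEdgeSet (T.erase s(z, w') : Set (Sym2 V))).Reachable y z ∧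
      (fromEdgeSet (T.erase s(z, w') : Set (Sym2 V))).Reachable x w' := by
  have hnzw := (isTree_erase hT hzw hw).2.1
  obtain ⟨w', hw', -, hr'⟩ := exists_firstEdge hT hzx
  refine ⟨w', hw', ?_, hr'.symm⟩
  have hnyz : ¬ (fromEdgeSet (T.erase s(z, w) : Set (Sym2 V))).Reachable y z :=
    fun h ↦ hnzw (h.symm.trans hyw)
  have h1 : (fromEdgeSet (T.erase s(z, w') : Set (Sym2 V))).Reachable y w :=
    reachable_erase_of_not_reachable hyw hnyz
  have hww' : w ≠ w' := by
    rintro rfl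
    exact hnyz (hyw.trans (hr'.trans hxz))
  have h2 : (fromEdgeSet (T.erase s(z, w') : Set (Sym2 V))).Adj w z := by
    rw [fromEdgeSet_adj]
    refine ⟨?_, hzw.symm⟩
    rw [Finset.mem_coe, mem_erase, Sym2.eq_swap (a := w) (b := z)]
    exact ⟨fun h ↦ hww' (Sym2.congr_right.1 h), hw⟩
  exact h1.trans h2.reachable

/-! ### Counting the crossings of one spanning tree at a vertex

For a spanning tree `T` and vertices `x, y, z`, the *crossings of `T` at `z` from `x` to `y`* are
the `w` with `zw ∈ T` such that `T - zw` has `x, z` on one side and `y, w` on the other; there is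
at most one (the edge after `z` on the `x`–`y` path of `T`, when `z` lies on it). -/

variable [Fintype V] (G : SimpleGraph V) [DecidableRel G.Adj]

omit [DecidableEq V] in
/-- Elements of a spanning-tree edge set are genuine edges, hence not loops. [folklore] -/
theorem ne_of_mem_spanningTree {T : Finset (Sym2 V)} (hT : T ∈ spanningTreeEdgeSets G)
    {z w : V} (h : s(z, w) ∈ T) : z ≠ w :=
  ((mem_edgeSet G).1 (mem_edgeFinset.1 ((mem_spanningTreeEdgeSets_iff.1 hT).1 h))).ne

open Classical in
/-- At most one tree edge `zw` has `x, z` on one side and `y, w` on the other. [folklore] -/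
theorem card_treeCross_le_one {T : Finset (Sym2 V)} (hT : T ∈ spanningTreeEdgeSets G)
    (x y z : V) :
    #{w | s(z, w) ∈ T ∧ (fromEdgeSet (T.erase s(z, w) : Set (Sym2 V))).Reachable x z ∧
      (fromEdgeSet (T.erase s(z, w) : Set (Sym2 V))).Reachable y w} ≤ 1 := by
  obtain ⟨-, htree⟩ := mem_spanningTreeEdgeSets_iff.1 hT
  refine card_le_one.2 fun w₁ h₁ w₂ h₂ ↦ ?_
  obtain ⟨-, he₁, -, hy₁⟩ := mem_filter.1 h₁
  obtain ⟨-, he₂, -, hy₂⟩ := mem_filter.1 h₂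
  have hb : ∀ {w}, s(z, w) ∈ T → (fromEdgeSet (T.erase s(z, w) : Set (Sym2 V))).Reachable y w →
      ¬ (fromEdgeSet (T.erase s(z, w) : Set (Sym2 V))).Reachable z y :=
    fun he hy hzy ↦ (isTree_erase htree (ne_of_mem_spanningTree G hT he) he).2.1 (hzy.trans hy)
  exact firstEdge_unique he₁ (hb he₁ hy₁) hy₁.symm (hb he₂ hy₂)

open Classical in
/-- At `z = x` there is such an edge: the first edge of the path from `x` to `y`. [folklore] -/
theorem treeCross_self_pos {T : Finset (Sym2 V)} (hT : T ∈ spanningTreeEdgeSets G) {x y : V}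
    (hxy : x ≠ y) :
    0 < #{w | s(x, w) ∈ T ∧ (fromEdgeSet (T.erase s(x, w) : Set (Sym2 V))).Reachable x x ∧
      (fromEdgeSet (T.erase s(x, w) : Set (Sym2 V))).Reachable y w} := by
  obtain ⟨-, htree⟩ := mem_spanningTreeEdgeSets_iff.1 hT
  obtain ⟨w, he, -, hwy⟩ := exists_firstEdge htree hxy
  exact card_pos.2 ⟨w, mem_filter.2 ⟨mem_univ _, he, Reachable.refl _, hwy.symm⟩⟩

open Classical in
/-- No tree edge `xw` has `x` on the side of `w`. [folklore] -/
theorem treeCross_self_swap {T : Finset (Sym2 V)} (hT : T ∈ spanningTreeEdgeSets G) (x y : V) :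
    #{w | s(x, w) ∈ T ∧ (fromEdgeSet (T.erase s(x, w) : Set (Sym2 V))).Reachable y x ∧
      (fromEdgeSet (T.erase s(x, w) : Set (Sym2 V))).Reachable x w} = 0 := by
  obtain ⟨-, htree⟩ := mem_spanningTreeEdgeSets_iff.1 hT
  refine card_eq_zero.2 (filter_eq_empty_iff.2 fun w _ h ↦ ?_)
  exact (isTree_erase htree (ne_of_mem_spanningTree G hT h.1) h.1).2.1 h.2.2

open Classical in
/-- The exchange step, counted: away from `x`, a crossing `x, z | y, w` produces a crossing
`y, z | x, w'`. [folklore] -/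
theorem treeCross_pos_swap {T : Finset (Sym2 V)} (hT : T ∈ spanningTreeEdgeSets G) {x y z : V}
    (hzx : z ≠ x)
    (h : 0 < #{w | s(z, w) ∈ T ∧ (fromEdgeSet (T.erase s(z, w) : Set (Sym2 V))).Reachable x z ∧
      (fromEdgeSet (T.erase s(z, w) : Set (Sym2 V))).Reachable y w}) :
    0 < #{w | s(z, w) ∈ T ∧ (fromEdgeSet (T.erase s(z, w) : Set (Sym2 V))).Reachable y z ∧
      (fromEdgeSet (T.erase s(z, w) : Set (Sym2 V))).Reachable x w} := by
  obtain ⟨-, htree⟩ := mem_spanningTreeEdgeSets_iff.1 hT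
  obtain ⟨w, hw⟩ := card_pos.1 h
  obtain ⟨-, he, hxz, hyw⟩ := mem_filter.1 hw
  obtain ⟨w', he', hyz, hxw'⟩ :=
    exists_crossEdge htree hzx (ne_of_mem_spanningTree G hT he) he hxz hyw
  exact card_pos.2 ⟨w', mem_filter.2 ⟨mem_univ _, he', hyz, hxw'⟩⟩

open Classical in
/-- **Kirchhoff's current law for a single spanning tree** (Grimmett 2018, proof of Theorem 1.16:
"`π` arrives at `v` along some edge `⟨a, v⟩` and departs `v` along some edge `⟨v, b⟩`"): for
`z ≠ y`, the number of tree edges `zw` with `x, z | y, w` minus the number with `y, z | x, w` is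
`[z = x]`. Here with a weight `a`. [folklore] -/
theorem sum_treeCross_sub {T : Finset (Sym2 V)} (hT : T ∈ spanningTreeEdgeSets G) {x y z : V}
    (hzy : z ≠ y) (a : ℝ) :
    ∑ w, ((if s(z, w) ∈ T ∧ (fromEdgeSet (T.erase s(z, w) : Set (Sym2 V))).Reachable x z ∧
            (fromEdgeSet (T.erase s(z, w) : Set (Sym2 V))).Reachable y w then a else 0) -
        (if s(z, w) ∈ T ∧ (fromEdgeSet (T.erase s(z, w) : Set (Sym2 V))).Reachable y z ∧
            (fromEdgeSet (T.erase s(z, w) : Set (Sym2 V))).Reachable x w then a else 0)) =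
      if z = x then a else 0 := by
  rw [sum_sub_distrib, ← sum_filter, ← sum_filter, sum_const, sum_const]
  by_cases hzx : z = x
  · subst hzx
    rw [if_pos rfl, le_antisymm (card_treeCross_le_one G hT _ y _) (treeCross_self_pos G hT hzy),
      treeCross_self_swap G hT _ y]
    simp
  · rw [if_neg hzx]
    have h1 := card_treeCross_le_one G hT x y z
    have h2 := card_treeCross_le_one G hT y x z
    rcases Nat.eq_zero_or_pos
      #{w | s(z, w) ∈ T ∧ (fromEdgeSet (T.erase s(z, w) : Set (Sym2 V))).Reachable x z ∧
        (fromEdgeSet (T.erase s(z, w) : Set (Sym2 V))).Reachable y w} with h0 | hpos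
    · have h0' : #{w | s(z, w) ∈ T ∧
          (fromEdgeSet (T.erase s(z, w) : Set (Sym2 V))).Reachable y z ∧
          (fromEdgeSet (T.erase s(z, w) : Set (Sym2 V))).Reachable x w} = 0 := by
        by_contra hne
        have h' := treeCross_pos_swap G hT hzy (Nat.pos_of_ne_zero hne)
        rw [h0] at h'
        exact lt_irrefl 0 h'
      rw [h0, h0']
      simp
    · rw [le_antisymm h1 hpos, le_antisymm h2 (treeCross_pos_swap G hT hzx hpos), sub_self]

/-! ### The bush–tree correspondence and Kirchhoff's current law for the 2-forest potential -/

/-- Adding the edge `zw` of `G` to a spanning 2-forest separating `x` from `y`, with `z` on the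
side of `x` and `w` on the side of `y`, gives a spanning tree of `G` (Grimmett 2018, proof of
Theorem 1.16: `ℬ(s, a, b, t) → 𝒩(s, a, b, t)`). [folklore] -/
theorem insert_mem_spanningTreeEdgeSets {F : Finset (Sym2 V)} {x y z w : V}
    (hF : F ∈ twoForestEdgeSets G x y) (hadj : G.Adj z w)
    (hxz : (fromEdgeSet (F : Set (Sym2 V))).Reachable x z)
    (hyw : (fromEdgeSet (F : Set (Sym2 V))).Reachable y w) :
    s(z, w) ∉ F ∧ insert s(z, w) F ∈ spanningTreeEdgeSets G := by
  rw [mem_twoForestEdgeSets_iff] at hF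
  obtain ⟨hFE, hacyc, hnxy, hcov⟩ := hF
  have hzw : z ≠ w := hadj.ne
  have hnzw : ¬ (fromEdgeSet (F : Set (Sym2 V))).Reachable z w :=
    fun h ↦ hnxy (hxz.trans (h.trans hyw.symm))
  have hnot : s(z, w) ∉ F := fun h ↦
    hnzw ((fromEdgeSet_adj _).2 ⟨Finset.mem_coe.2 h, hzw⟩).reachable
  refine ⟨hnot, mem_spanningTreeEdgeSets_iff.2 ⟨?_, ?_⟩⟩
  · exact insert_subset (mem_edgeFinset.2 ((mem_edgeSet G).2 hadj)) hFE
  · rw [coe_insert, isTree_fromEdgeSet_insert_iff hzw (by simpa using hnot)]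
    exact ⟨hacyc, hnzw, fun u ↦ (hcov u).imp (fun h ↦ hxz.symm.trans h) fun h ↦ hyw.symm.trans h⟩

/-- Removing from a spanning tree an edge `zw` with `x, z` on one side and `y, w` on the other
gives a spanning 2-forest separating `x` from `y` (Grimmett 2018, proof of Theorem 1.16:
`𝒩(s, a, b, t) → ℬ(s, a, b, t)`). [folklore] -/
theorem erase_mem_twoForestEdgeSets {T : Finset (Sym2 V)} {x y z w : V}
    (hT : T ∈ spanningTreeEdgeSets G) (he : s(z, w) ∈ T)
    (hxz : (fromEdgeSet (T.erase s(z, w) : Set (Sym2 V))).Reachable x z)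
    (hyw : (fromEdgeSet (T.erase s(z, w) : Set (Sym2 V))).Reachable y w) :
    G.Adj z w ∧ T.erase s(z, w) ∈ twoForestEdgeSets G x y := by
  obtain ⟨hTE, htree⟩ := mem_spanningTreeEdgeSets_iff.1 hT
  have hadj : G.Adj z w := (mem_edgeSet G).1 (mem_edgeFinset.1 (hTE he))
  obtain ⟨hacyc, hnzw, hcov⟩ := isTree_erase htree hadj.ne he
  refine ⟨hadj, mem_twoForestEdgeSets_iff.2
    ⟨(erase_subset _ _).trans hTE, hacyc, fun hxy ↦ hnzw ?_, fun u ↦ ?_⟩⟩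
  · exact hxz.symm.trans (hxy.trans hyw)
  · exact (hcov u).imp (fun h ↦ hxz.trans h) fun h ↦ hyw.trans h

open Classical in
/-- **The bush–tree correspondence** `F ↦ F + zw` at a fixed ordered pair `(z, w)`, with
weights: `c(zw) · Σ {wt(F) : F ∈ ℱ(x | y), z ~ x, w ~ y} = Σ {wt(T) : T ∋ zw, (x, z | y, w) in
T - zw}` (Grimmett 2018, proof of Theorem 1.16, the one–one correspondence
`ℬ(s, a, b, t) ↔ 𝒩(s, a, b, t)`). [folklore] -/
theorem sum_twoForest_cross_eq_sum_tree (c : Sym2 V → ℝ≥0) (x y z w : V) :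
    ∑ F ∈ twoForestEdgeSets G x y,
        (if G.Adj z w ∧ (fromEdgeSet (F : Set (Sym2 V))).Reachable x z ∧
            (fromEdgeSet (F : Set (Sym2 V))).Reachable y w
          then (c s(z, w) : ℝ) * ∏ f ∈ F, (c f : ℝ) else 0) =
      ∑ T ∈ spanningTreeEdgeSets G,
        (if s(z, w) ∈ T ∧ (fromEdgeSet (T.erase s(z, w) : Set (Sym2 V))).Reachable x z ∧
            (fromEdgeSet (T.erase s(z, w) : Set (Sym2 V))).Reachable y w
          then ∏ f ∈ T, (c f : ℝ) else 0) := by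
  rw [← sum_filter, ← sum_filter]
  refine sum_nbij' (fun F ↦ insert s(z, w) F) (fun T ↦ T.erase s(z, w)) ?_ ?_ ?_ ?_ ?_
  · intro F hF
    obtain ⟨hF, hadj, hxz, hyw⟩ := mem_filter.1 hF
    obtain ⟨hnot, hT⟩ := insert_mem_spanningTreeEdgeSets G hF hadj hxz hyw
    refine mem_filter.2 ⟨hT, mem_insert_self _ _, ?_⟩
    rw [erase_insert hnot]
    exact ⟨hxz, hyw⟩
  · intro T hT
    obtain ⟨hT, he, hxz, hyw⟩ := mem_filter.1 hT
    obtain ⟨hadj, hF⟩ := erase_mem_twoForestEdgeSets G hT he hxz hyw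
    exact mem_filter.2 ⟨hF, hadj, hxz, hyw⟩
  · intro F hF
    obtain ⟨hF, hadj, hxz, hyw⟩ := mem_filter.1 hF
    exact erase_insert (insert_mem_spanningTreeEdgeSets G hF hadj hxz hyw).1
  · intro T hT
    exact insert_erase (mem_filter.1 hT).2.1
  · intro F hF
    obtain ⟨hF, hadj, hxz, hyw⟩ := mem_filter.1 hF
    rw [prod_insert (insert_mem_spanningTreeEdgeSets G hF hadj hxz hyw).1]

omit [DecidableEq V] in
/-- `twoForestEdgeSets` is symmetric in the two poles. [folklore] -/
theorem twoForestEdgeSets_comm (x y : V) : twoForestEdgeSets G x y = twoForestEdgeSets G y x := by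
  ext F
  simp only [mem_twoForestEdgeSets_iff]
  constructor
  · rintro ⟨h1, h2, h3, h4⟩
    exact ⟨h1, h2, fun h ↦ h3 h.symm, fun u ↦ (h4 u).symm⟩
  · rintro ⟨h1, h2, h3, h4⟩
    exact ⟨h1, h2, fun h ↦ h3 h.symm, fun u ↦ (h4 u).symm⟩

omit [DecidableEq V] in
open Classical in
/-- In a 2-forest separating `x` from `y`, the difference of the indicators "`z` on the side of
`x`" and "`w` on the side of `x`" is the difference of the indicators of the two crossing
configurations `x, z | y, w` and `y, z | x, w`. [folklore] -/
theorem ite_reachable_sub_ite_reachable {F : Finset (Sym2 V)} {x y : V}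
    (hF : F ∈ twoForestEdgeSets G x y) (z w : V) (a : ℝ) :
    ((if (fromEdgeSet (F : Set (Sym2 V))).Reachable x z then a else 0) -
        if (fromEdgeSet (F : Set (Sym2 V))).Reachable x w then a else 0) =
      (if (fromEdgeSet (F : Set (Sym2 V))).Reachable x z ∧
          (fromEdgeSet (F : Set (Sym2 V))).Reachable y w then a else 0) -
        if (fromEdgeSet (F : Set (Sym2 V))).Reachable y z ∧
          (fromEdgeSet (F : Set (Sym2 V))).Reachable x w then a else 0 := by
  obtain ⟨-, -, hnxy, hcov⟩ := mem_twoForestEdgeSets_iff.1 hF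
  have hy : ∀ u, (fromEdgeSet (F : Set (Sym2 V))).Reachable y u ↔
      ¬ (fromEdgeSet (F : Set (Sym2 V))).Reachable x u := fun u ↦
    ⟨fun hyu hxu ↦ hnxy (hxu.trans hyu.symm), fun h ↦ (hcov u).resolve_left h⟩
  simp only [hy]
  by_cases hz : (fromEdgeSet (F : Set (Sym2 V))).Reachable x z <;>
    by_cases hw : (fromEdgeSet (F : Set (Sym2 V))).Reachable x w <;> simp [hz, hw]

open Classical in
/-- **Kirchhoff's current law for the 2-forest potential** (Kirchhoff 1847; Grimmett 2018,
Theorem 1.16, in the "bush" form of its proof): with `ℱ` the spanning 2-forests separating `x`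
from `y` and `N(z) = Σ_{F ∈ ℱ, z on the side of x} Π_{f ∈ F} c(f)`, for every `z ≠ y`
`Σ_{w ~ z} c(zw) (N(z) - N(w)) = [z = x] · Σ_{T spanning tree} Π_{f ∈ T} c(f)`: the function `N`
is harmonic off `{x, y}` and the total current out of `x` is the tree sum.
[cite: Grimmett2018, §1.2, Theorem 1.16 and its proof] -/
theorem laplacian_twoForestPotential (c : Sym2 V → ℝ≥0) (x y z : V) (hzy : z ≠ y) :
    ∑ w, (if G.Adj z w then (c s(z, w) : ℝ) *
        ((∑ F ∈ twoForestEdgeSets G x y,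
            if (fromEdgeSet (F : Set (Sym2 V))).Reachable x z then ∏ f ∈ F, (c f : ℝ) else 0) -
          ∑ F ∈ twoForestEdgeSets G x y,
            if (fromEdgeSet (F : Set (Sym2 V))).Reachable x w then ∏ f ∈ F, (c f : ℝ) else 0)
        else 0) =
      if z = x then ∑ T ∈ spanningTreeEdgeSets G, ∏ f ∈ T, (c f : ℝ) else 0 := by
  -- Step 1: each summand is a difference of two bush sums
  have h1 : ∀ w, (if G.Adj z w then (c s(z, w) : ℝ) *
        ((∑ F ∈ twoForestEdgeSets G x y,
            if (fromEdgeSet (F : Set (Sym2 V))).Reachable x z then ∏ f ∈ F, (c f : ℝ) else 0) -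
          ∑ F ∈ twoForestEdgeSets G x y,
            if (fromEdgeSet (F : Set (Sym2 V))).Reachable x w then ∏ f ∈ F, (c f : ℝ) else 0)
        else 0) =
      (∑ F ∈ twoForestEdgeSets G x y,
          if G.Adj z w ∧ (fromEdgeSet (F : Set (Sym2 V))).Reachable x z ∧
              (fromEdgeSet (F : Set (Sym2 V))).Reachable y w
            then (c s(z, w) : ℝ) * ∏ f ∈ F, (c f : ℝ) else 0) -
        ∑ F ∈ twoForestEdgeSets G y x,
          if G.Adj z w ∧ (fromEdgeSet (F : Set (Sym2 V))).Reachable y z ∧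
              (fromEdgeSet (F : Set (Sym2 V))).Reachable x w
            then (c s(z, w) : ℝ) * ∏ f ∈ F, (c f : ℝ) else 0 := by
    intro w
    rw [← twoForestEdgeSets_comm G x y]
    by_cases hadj : G.Adj z w
    · simp only [hadj, true_and, ↓reduceIte]
      rw [← sum_sub_distrib, ← sum_sub_distrib, mul_sum]
      refine sum_congr rfl fun F hF ↦ ?_
      rw [ite_reachable_sub_ite_reachable G hF z w, mul_sub, mul_ite, mul_ite, mul_zero]
    · simp [hadj]
  -- Step 2: bush sums are tree sums (`sum_twoForest_cross_eq_sum_tree`)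
  have h2 : ∀ w, ((∑ F ∈ twoForestEdgeSets G x y,
          if G.Adj z w ∧ (fromEdgeSet (F : Set (Sym2 V))).Reachable x z ∧
              (fromEdgeSet (F : Set (Sym2 V))).Reachable y w
            then (c s(z, w) : ℝ) * ∏ f ∈ F, (c f : ℝ) else 0) -
        ∑ F ∈ twoForestEdgeSets G y x,
          (if G.Adj z w ∧ (fromEdgeSet (F : Set (Sym2 V))).Reachable y z ∧
              (fromEdgeSet (F : Set (Sym2 V))).Reachable x w
            then (c s(z, w) : ℝ) * ∏ f ∈ F, (c f : ℝ) else 0)) =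
      ∑ T ∈ spanningTreeEdgeSets G,
        ((if s(z, w) ∈ T ∧ (fromEdgeSet (T.erase s(z, w) : Set (Sym2 V))).Reachable x z ∧
              (fromEdgeSet (T.erase s(z, w) : Set (Sym2 V))).Reachable y w
            then ∏ f ∈ T, (c f : ℝ) else 0) -
          (if s(z, w) ∈ T ∧ (fromEdgeSet (T.erase s(z, w) : Set (Sym2 V))).Reachable y z ∧
              (fromEdgeSet (T.erase s(z, w) : Set (Sym2 V))).Reachable x w
            then ∏ f ∈ T, (c f : ℝ) else 0)) := fun w ↦ by
    rw [sum_twoForest_cross_eq_sum_tree, sum_twoForest_cross_eq_sum_tree, ← sum_sub_distrib]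
  simp only [h1, h2]
  -- Step 3: swap the sums; for each tree the crossings at `z` telescope (`sum_treeCross_sub`)
  rw [sum_comm]
  have h3 : ∀ T ∈ spanningTreeEdgeSets G,
      ∑ w, ((if s(z, w) ∈ T ∧ (fromEdgeSet (T.erase s(z, w) : Set (Sym2 V))).Reachable x z ∧
              (fromEdgeSet (T.erase s(z, w) : Set (Sym2 V))).Reachable y w
            then ∏ f ∈ T, (c f : ℝ) else 0) -
          (if s(z, w) ∈ T ∧ (fromEdgeSet (T.erase s(z, w) : Set (Sym2 V))).Reachable y z ∧
              (fromEdgeSet (T.erase s(z, w) : Set (Sym2 V))).Reachable x w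
            then ∏ f ∈ T, (c f : ℝ) else 0)) =
        if z = x then ∏ f ∈ T, (c f : ℝ) else 0 := fun T hT ↦
    sum_treeCross_sub G hT hzy _
  rw [sum_congr rfl h3]
  by_cases hzx : z = x <;> simp [hzx]

open Classical in
/-- The numerator of Kirchhoff's formula: the spanning trees through `xy` weigh `c(xy)` times the
spanning 2-forests separating `x` from `y` (`T ↦ T - xy`; Lyons–Peres 2016, solution to
Exercise 4.30; Bondy–Murty 2008, proof of Theorem 20.22). [folklore] -/
theorem sum_filter_mem_spanningTree_eq (c : Sym2 V → ℝ≥0) {x y : V} (hadj : G.Adj x y) :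
    ∑ T ∈ (spanningTreeEdgeSets G).filter (fun T ↦ s(x, y) ∈ T), ∏ f ∈ T, (c f : ℝ) =
      (c s(x, y) : ℝ) * ∑ F ∈ twoForestEdgeSets G x y, ∏ f ∈ F, (c f : ℝ) := by
  have h := sum_twoForest_cross_eq_sum_tree G c x y x y
  simp only [hadj, Reachable.refl, and_self, and_true, ↓reduceIte] at h
  rw [← mul_sum] at h
  rw [sum_filter, ← h]

/-! ### Kirchhoff's effective resistance formula -/

open Classical in
/-- **Kirchhoff's effective resistance formula** (Kirchhoff 1847; Lyons–Peres 2016, §4.2,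
"Kirchhoff's Effective Resistance Formula": `P[e ∈ T] = c(e) ℛ(e⁻ ↔ e⁺)` for the weighted
uniform spanning tree `T`), in the spanning-tree-ratio form of the named fact
`KirchhoffEdgeFormula`: for a finite connected network with positive conductances and an edge
`xy`, `Σ_{t ∋ xy} Π_{f ∈ t} c(f) / Σ_t Π_{f ∈ t} c(f) = c(xy) · ℛ(x ↔ y)`. Proof: Kirchhoff's
combinatorial construction of the current (Grimmett 2018, Theorem 1.16) in potential form —
`laplacian_twoForestPotential` — and Dirichlet's principle `effectiveConductance_eq_of_harmonic`.
[cite: LyonsPeres2016, §4.2 (Electrical Interpretations), Kirchhoff's Effective Resistance Formula] -/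
theorem KirchhoffEdgeFormula_holds : KirchhoffEdgeFormula := by
  intro V _ _ G _ c hconn hpos x y hadj
  have hxy : x ≠ y := hadj.ne
  -- weights of spanning trees and of 2-forests are positive
  have hwT : ∀ T ∈ spanningTreeEdgeSets G, (0 : ℝ) < ∏ f ∈ T, (c f : ℝ) := fun T hT ↦
    prod_pos fun f hf ↦ NNReal.coe_pos.2
      (hpos f (mem_edgeFinset.1 ((mem_spanningTreeEdgeSets_iff.1 hT).1 hf)))
  have hwF : ∀ F ∈ twoForestEdgeSets G x y, (0 : ℝ) < ∏ f ∈ F, (c f : ℝ) := fun F hF ↦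
    prod_pos fun f hf ↦ NNReal.coe_pos.2
      (hpos f (mem_edgeFinset.1 ((mem_twoForestEdgeSets_iff.1 hF).1 hf)))
  -- a spanning tree exists, and removing its first edge on the way from `x` to `y` gives a
  -- separating 2-forest: both sums below are positive
  obtain ⟨T₀, hT₀G, hT₀⟩ := hconn.exists_isTree_le
  have hS : (Set.toFinite T₀.edgeSet).toFinset ∈ spanningTreeEdgeSets G := by
    refine mem_spanningTreeEdgeSets_iff.2 ⟨fun e he ↦ ?_, ?_⟩
    · exact mem_edgeFinset.2 (edgeSet_mono hT₀G ((Set.Finite.mem_toFinset _).1 he))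
    · rw [Set.Finite.coe_toFinset, fromEdgeSet_edgeSet]
      exact hT₀
  have hTpos : (0 : ℝ) < ∑ T ∈ spanningTreeEdgeSets G, ∏ f ∈ T, (c f : ℝ) :=
    sum_pos hwT ⟨_, hS⟩
  obtain ⟨w₀, he₀, -, hwy₀⟩ := exists_firstEdge (mem_spanningTreeEdgeSets_iff.1 hS).2 hxy
  have hDpos : (0 : ℝ) < ∑ F ∈ twoForestEdgeSets G x y, ∏ f ∈ F, (c f : ℝ) :=
    sum_pos hwF ⟨_, (erase_mem_twoForestEdgeSets G hS he₀ (Reachable.refl _) hwy₀.symm).2⟩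
  -- the 2-forest potential is harmonic off `{x, y}`: Dirichlet's principle evaluates `𝒞(x ↔ y)`
  have hC : effectiveConductance G c {x} {y} = ENNReal.ofReal
      ((∑ T ∈ spanningTreeEdgeSets G, ∏ f ∈ T, (c f : ℝ)) /
        ∑ F ∈ twoForestEdgeSets G x y, ∏ f ∈ F, (c f : ℝ)) := by
    refine effectiveConductance_eq_of_harmonic G c
      (fun z ↦ ∑ F ∈ twoForestEdgeSets G x y,
        if (fromEdgeSet (F : Set (Sym2 V))).Reachable x z then ∏ f ∈ F, (c f : ℝ) else 0)
      hDpos ?_ ?_ fun z hz ↦ laplacian_twoForestPotential G c x y z hz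
    · exact sum_congr rfl fun F _ ↦ if_pos (Reachable.refl _)
    · exact sum_eq_zero fun F hF ↦ if_neg (mem_twoForestEdgeSets_iff.1 hF).2.2.1
  -- numerator and denominator as real numbers
  have hnum : (((∑ t ∈ (spanningTreeEdgeSets G).filter (fun t ↦ s(x, y) ∈ t), ∏ f ∈ t, c f :
      ℝ≥0) : ℝ≥0∞)) = ENNReal.ofReal ((c s(x, y) : ℝ) *
        ∑ F ∈ twoForestEdgeSets G x y, ∏ f ∈ F, (c f : ℝ)) := by
    rw [← ENNReal.ofReal_coe_nnreal, NNReal.coe_sum, ← sum_filter_mem_spanningTree_eq G c hadj]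
    simp_rw [NNReal.coe_prod]
  have hden : (((∑ t ∈ spanningTreeEdgeSets G, ∏ f ∈ t, c f : ℝ≥0) : ℝ≥0∞)) =
      ENNReal.ofReal (∑ T ∈ spanningTreeEdgeSets G, ∏ f ∈ T, (c f : ℝ)) := by
    rw [← ENNReal.ofReal_coe_nnreal, NNReal.coe_sum]
    simp_rw [NNReal.coe_prod]
  rw [hnum, hden, effectiveResistance_def, hC, ← ENNReal.ofReal_div_of_pos hTpos,
    ← ENNReal.ofReal_inv_of_pos (div_pos hTpos hDpos), ← ENNReal.ofReal_coe_nnreal,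
    ← ENNReal.ofReal_mul (NNReal.coe_nonneg _), inv_div, mul_div_assoc]

end Trees

end

end Literature.Probability.LatticeModels
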